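import Literature.AnabelianGeometry.EtaleTheta.Discharge.Sec3PhiZeroCountablePrimesConnected
import Literature.AnabelianGeometry.EtaleTheta.Discharge.Sec3Cor38iiiOfRlfWeak
import Literature.AnabelianGeometry.EtaleTheta.Discharge.Sec3Cor38iiiOfRlfRWeak
import Literature.AnabelianGeometry.EtaleTheta.Discharge.Sec3Thm37ivGenuineBase
import Literature.AnabelianGeometry.EtaleTheta.BiKummerThm44SubModelConnectedOfGaloisCovering
import Literature.AnabelianGeometry.EtaleTheta.Discharge.Sec3BLambdaInjectiveOfGaloisCoveringConnected
import Literature.AnabelianGeometry.EtaleTheta.RealificationPfImageWeak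
import Literature.AnabelianGeometry.EtaleTheta.TemperedFrobenioidOfGaloisCoveringRankOnePoint
import Literature.AnabelianGeometry.EtaleTheta.TemperedFrobenioidOfGaloisCoveringTateTower
import Literature.AnabelianGeometry.EtaleTheta.TemperedFrobenioidOfGaloisCoveringRankOnePointR
import Literature.AnabelianGeometry.EtaleTheta.Discharge.Sec3Prop34ConstTateTower
import HarnessLib

/-!
# [EtTh] Cor. 3.8 (iii), first clause, FIRED at the rank-one-point tempered Frobenioids over the constructed connected
# Def. 3.3 (iii) data — and at the TATE TOWER, the cell's first non-degenerate model (`hcnt` and `IsFrobenioid` CLOSED)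

S. Mochizuki, *The étale theta function and its Frobenioid-theoretic manifestations*, Publ. RIMS **45** (2009)
[MochizukiEtTh2009], §3: Cor. 3.8 (iii) PDF p.81 (proof p.82 "by considering the factorization homomorphisms"), Def. 3.3
(iii) p.73, Def. 3.6 (ii) p.77, Ex. 3.9 (iii) p.84 (print's `Φ := ι(Φ₀^pf)`); [FrdII] Ex. 1.1 (the `p`-adic Frobenioid of a
field) [cite: MochizukiEtTh2009, Cor 3.8 p.81].

abc-iut cell, layer L2, PROOF-ONLY file (theorems only), seat abc-iut-w6-d052 (gen 6), row R365 of abc-iut-L2-lead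
«COR 3.8 (iii) KNIT INSTANTIATED AT A := TateTower.action».  abc-iut-L2-d2's weak Cor. 3.8 (iii) apices
`cor38_iii_ofRlfZWeak_of_isFrobenioid_of_countable_of_prop34Const` (`Λ = ℤ`) / `cor38_iii_ofRlfRWeak_…` (`Λ = ℝ`, p443086) are FIRED at
abc-iut-w6-d048's rank-one-point tempered Frobenioids `TemperedFrobenioid.ofRankOnePoint hZ P hpf R S` / `ofRankOnePointR`
(`TemperedFrobenioidOfGaloisCoveringRankOnePoint(R).lean`: base `{pt} ↦ S₀`, `Φ := im(Φ₀(S₀)^pf → Φ₀(S₀)^rlf)` — so the Φ-tie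
`Φ(B) = ι(Φ₀(Y_B)^pf)` is `rfl`), with `hcnt_i` CLOSED (this seat's p441898 ∘ abc-iut-w5-d153's p440853: `Prime(Φ₀(Y)^pf)` countable
at the connected coverings for countable `G`, cusps, components) and `IsFrobenioid_i` CLOSED (`TemperedFrobenioid.isFrobenioid_of_isOfFSMType`,
the one-point base being of FSM-type, with the `B_Λ`-injectivity of abc-iut-w5-d179 / abc-iut-w6-d048); and then at abc-iut-w6-d058's
TATE TOWER (`LogDivisorModelTateTower.lean`, p444705: `Z := TateTower.model`, `G := Multiplicative ℤ`, `A := TateTower.action`, cusps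
`PEmpty`, components `ℤ` — all three index types COUNTABLE), where the last named input `Prop34Const` is this seat's THEOREM
`LogDivisorModel.TateTower.prop34Const_ofGaloisActionConnected` (p448109):

* `ofRankOnePoint_Φ_eq_mrange` — the Φ-tie (`rfl`; its `Λ = ℝ` twin is abc-iut-L2-d2's `ofRankOnePointR_Φ_eq_mrange`); `countable_primes_perfection_Φ_ofRankOnePoint(R)` — `hcnt` closed;
* `ofRankOnePoint_nonDilating`, `nonempty_cor38Hyp_ofRankOnePoint` — the Cor. 3.8 datum is INHABITED between two rank-one-point
  Frobenioids (`Ψ := 𝟭`, `{pt}` of FSMFF-type, `Φ` non-dilating under the endomorphisms of the one-point base);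
* **`TemperedFrobenioid.cor38_iii_ofRankOnePoint`** / `cor38_iii_ofRankOnePointR` — `Cor38_iii h` for EVERY Cor. 3.8 datum `h` between two
  rank-one-point Frobenioids over `(Z, G, A)`, `(Z', G', A')` with countable `G`, cusps, components: the ONLY remaining named input is
  `Prop34Const` of the two Def. 3.3 (iii) records (GAP-LEDGER G-L2d2-3); `exists_cor38Hyp_cor38_iii_ofRankOnePoint` (∃-form);
* **`LogDivisorModel.TateTower.cor38_iii_ofRankOnePoint`** / `….exists_cor38Hyp_cor38_iii` / `cor38_iii_tateTowerFrd` (abc-iut-w6-d048's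
  instance of record `TateTowerFrd.temperedFrobenioid`, p446077) — the same AT THE TATE TOWER modulo `Prop34Const`, and
* **`LogDivisorModel.TateTower.cor38_iii_ofRankOnePoint_unconditional`**, `exists_cor38Hyp_cor38_iii_unconditional`,
  **`cor38_iii_tateTowerFrd_unconditional`**, `cor38_iii_ofRankOnePointR_unconditional`, `cor38_iii_tateTowerFrdR_unconditional` —
  **[EtTh] Cor. 3.8 (iii), first clause, WITH NO HYPOTHESIS at the cell's first non-degenerate §3 model, monoid types `ℤ` and `ℝ`.**

HONEST FRAMING: instantiation / consistency evidence at constructed data and a synthetic model (the Tate tower is a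
`LogDivisorModel` record, not a curve); nothing of [EtTh] asserted beyond what is proved; no side taken on [IUTchIII]
Cor. 3.12; typed ≠ proved — here proved.
-/

noncomputable section

namespace Literature.AnabelianGeometry.EtaleTheta

open CategoryTheory Opposite Literature.AlgebraicGeometry.Frobenioids LogDivisorModel.GaloisAction

namespace TemperedFrobenioid

variable {Z : LogDivisorModel.{0}} {G : Type} [Group G] {A : Z.GaloisAction G} (hZ : Z.CuspLaws) (P : RankOnePoint A)
  (hpf : ∀ Y : ((isConnectedGSet (G := G)).FullSubcategory)ᵒᵖ,
    IsPerfFactorialCof ((DivisorMonoids.ofGaloisActionConnected A hZ).Φ₀.obj Y))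
  (R S : ((Discrete PUnit.{1})ᵒᵖ ⥤ CommMonCat.{0}) → Prop)
  {Z' : LogDivisorModel.{0}} {G' : Type} [Group G'] {A' : Z'.GaloisAction G'} (hZ' : Z'.CuspLaws) (P' : RankOnePoint A')
  (hpf' : ∀ Y : ((isConnectedGSet (G := G')).FullSubcategory)ᵒᵖ,
    IsPerfFactorialCof ((DivisorMonoids.ofGaloisActionConnected A' hZ').Φ₀.obj Y))
  (R' S' : ((Discrete PUnit.{1})ᵒᵖ ⥤ CommMonCat.{0}) → Prop)

/-! ### The Φ-tie and the Cor. 3.8 datum at a rank-one point -/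

/-- **The Φ-tie at `ofRankOnePoint` is definitional**: `Φ(B) = ι(Φ₀(S₀)^pf) = im(Φ₀(Y_B)^pf → Φ₀(Y_B)^rlf)` with `Y_B = S₀`
(print's choice of `Φ`, [EtTh] Ex. 3.9 (iii)). [cite: MochizukiEtTh2009, Def 3.6 p.77] -/
theorem ofRankOnePoint_Φ_eq_mrange (B : (Discrete PUnit.{1})ᵒᵖ) :
    (ofRankOnePoint hZ P hpf R S).Φ.carrier B =
      MonoidHom.mrange (hpf ((ofRankOnePoint hZ P hpf R S).baseOp B)).weak.toRealification :=
  rfl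

/-- `Φ` of a rank-one-point Frobenioid is non-dilating under the endomorphisms of its one-point base (identities).
[cite: MochizukiEtTh2009, Cor 3.8 p.80] -/
theorem ofRankOnePoint_nonDilating (B : (Discrete PUnit.{1})ᵒᵖ) (f : B ⟶ B) :
    treeMonoidVocabWeak.IsNonDilating _ ((ofRankOnePoint hZ P hpf R S).Φ.pull f) := by
  have hf : f = 𝟙 B := Quiver.Hom.unop_inj (Subsingleton.elim _ _)
  subst hf
  rw [treeMonoidVocabWeak_isNonDilating]
  have hpull : (ofRankOnePoint hZ P hpf R S).Φ.pull (𝟙 B) = MonoidHom.id _ := by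
    ext x
    rw [SubMonoidOn.coe_pull, CategoryTheory.Functor.map_id, MonoidHom.id_apply]
    rfl
  rw [hpull]
  exact Example39NV.isNonDilating_id

/-- **The Cor. 3.8 datum is inhabited between two rank-one-point Frobenioids over the SAME data** (`Ψ := 𝟭`; the one-point
base is of FSM-, hence FSMFF-type; `Φ` non-dilating). [cite: MochizukiEtTh2009, Cor 3.8 p.80] -/
theorem nonempty_cor38Hyp_ofRankOnePoint :
    Nonempty (Cor38Hyp (ofRankOnePoint hZ P hpf R S) (ofRankOnePoint hZ P hpf R S)) :=
  ⟨{ Ψ := CategoryTheory.Equivalence.refl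
     fsmff := ⟨PadicFrd.isOfFSMType_discretePUnit.isOfFSMFFType, PadicFrd.isOfFSMType_discretePUnit.isOfFSMFFType⟩
     nonDilating := ⟨ofRankOnePoint_nonDilating hZ P hpf R S, ofRankOnePoint_nonDilating hZ P hpf R S⟩ }⟩

/-! ### Cor. 3.8 (iii), first clause, at rank-one points: residual = `Prop34Const` only -/

/-- **`hcnt` at a rank-one point, CLOSED** (countable `G`, cusps, components): `Prime(Φ(B)^pf)` is countable, because
`Φ(B) = ι(Φ₀(Y_B)^pf)` definitionally ([EtTh] Ex. 3.9 (iii)), `ι` is injective on `Φ₀^pf`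
(`PfImageWeak.mrangeRestrict_toRealification_bijective`), `Prime(M) ≃ Prime(M^pf)` for the sharp image, and `Prime(Φ₀(Y)^pf)` is
countable at the connected coverings (abc-iut-w6-d052 p441898 ∘ abc-iut-w5-d153 p440853). [cite: MochizukiEtTh2009, Ex 3.9 p.84] -/
theorem countable_primes_perfection_Φ_ofRankOnePoint [Countable G] [Countable Z.Cusp] [Countable Z.Comp]
    (B : (Discrete PUnit.{1})ᵒᵖ) : Countable (Primes (Perfection ↥((ofRankOnePoint hZ P hpf R S).Φ.carrier B))) := by
  have hM := hpf ((ofRankOnePoint hZ P hpf R S).baseOp B)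
  haveI := DivisorMonoids.countable_primes_perfection_Φ₀_ofGaloisActionConnected A hZ ((ofRankOnePoint hZ P hpf R S).baseOp B)
  haveI : Countable (Primes ↥(MonoidHom.mrange hM.weak.toRealification)) :=
    countable_primes_of_mulEquiv
      (MulEquiv.ofBijective _ (PfImageWeak.mrangeRestrict_toRealification_bijective hM.weak))
  exact (PfImageWeak.isPerfFactorialCof_mrange_toRealification hM).weak.countable_primes_perfection


/-- **[EtTh] Cor. 3.8 (iii), first clause, for EVERY Cor. 3.8 datum between two rank-one-point tempered Frobenioids over
constructed connected Def. 3.3 (iii) data with countable `G`, cusps and components** — abc-iut-L2-d2's `Λ = ℤ` apex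
`cor38_iii_ofRlfZWeak_of_isFrobenioid_of_countable_of_prop34Const` FIRED: `hcnt_i` (`countable_primes_perfection_Φ_ofRankOnePoint`),
`IsFrobenioid_i` (FSM-type one-point base, `TemperedFrobenioid.isFrobenioid_of_isOfFSMType` with abc-iut-w5-d179's
`ofGaloisActionConnected_ofRlfZWeak_hBinj`) are theorems here and the Φ-ties are `rfl`; the ONLY remaining named input is
`Prop34Const` of the two records (GAP-LEDGER G-L2d2-3) — discharged at the Tate tower below. [cite: MochizukiEtTh2009, Cor 3.8 p.81] -/
theorem cor38_iii_ofRankOnePoint [Countable G] [Countable Z.Cusp] [Countable Z.Comp] [Countable G'] [Countable Z'.Cusp]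
    [Countable Z'.Comp] (h : Cor38Hyp (ofRankOnePoint hZ P hpf R S) (ofRankOnePoint hZ' P' hpf' R' S'))
    (hC : (DivisorMonoids.ofGaloisActionConnected A hZ).Prop34Const)
    (hC' : (DivisorMonoids.ofGaloisActionConnected A' hZ').Prop34Const) : Cor38_iii h :=
  cor38_iii_ofRlfZWeak_of_isFrobenioid_of_countable_of_prop34Const h
    (fun B => countable_primes_perfection_Φ_ofRankOnePoint hZ P hpf R S B)
    (fun B => countable_primes_perfection_Φ_ofRankOnePoint hZ' P' hpf' R' S' B) hC hC'
    ((ofRankOnePoint hZ P hpf R S).isFrobenioid_of_isOfFSMType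
      (DivisorMonoids.ofGaloisActionConnected_ofRlfZWeak_hBinj A hZ hpf) PadicFrd.isOfFSMType_discretePUnit)
    ((ofRankOnePoint hZ' P' hpf' R' S').isFrobenioid_of_isOfFSMType
      (DivisorMonoids.ofGaloisActionConnected_ofRlfZWeak_hBinj A' hZ' hpf') PadicFrd.isOfFSMType_discretePUnit)

/-- **∃-form**: modulo `Prop34Const` of the record, `Cor38_iii` is INHABITED by a Cor. 3.8 datum between rank-one-point
Frobenioids over constructed connected data (countable `G`, cusps, components). [cite: MochizukiEtTh2009, Cor 3.8 p.81] -/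
theorem exists_cor38Hyp_cor38_iii_ofRankOnePoint [Countable G] [Countable Z.Cusp] [Countable Z.Comp]
    (hC : (DivisorMonoids.ofGaloisActionConnected A hZ).Prop34Const) :
    ∃ h : Cor38Hyp (ofRankOnePoint hZ P hpf R S) (ofRankOnePoint hZ P hpf R S), Cor38_iii h :=
  (nonempty_cor38Hyp_ofRankOnePoint hZ P hpf R S).elim fun h =>
    ⟨h, cor38_iii_ofRankOnePoint hZ P hpf R S hZ P hpf R S h hC hC⟩

end TemperedFrobenioid

/-! ### At the TATE TOWER (`Z := TateTower.model`, `G := Multiplicative ℤ`, `A := TateTower.action`) -/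

namespace LogDivisorModel.TateTower

open TemperedFrobenioid

variable (P P' : RankOnePoint TateTower.action)
  (hpf hpf' : ∀ Y : ((isConnectedGSet (G := Multiplicative ℤ)).FullSubcategory)ᵒᵖ,
    IsPerfFactorialCof ((DivisorMonoids.ofGaloisActionConnected TateTower.action TateTower.cuspLaws).Φ₀.obj Y))
  (R S R' S' : ((Discrete PUnit.{1})ᵒᵖ ⥤ CommMonCat.{0}) → Prop)

/-- **The Tate tower's index types are countable** (cusps `PEmpty`, special-fibre components `ℤ`, `G = ℤ`) — the three
instance binders of the `hcnt` producers, as FACTS of the model. [cite: MochizukiEtTh2009, Prop 3.2 p.70] -/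
theorem countable_cusp_comp_G :
    Countable TateTower.model.Cusp ∧ Countable TateTower.model.Comp ∧ Countable (Multiplicative ℤ) :=
  ⟨show Countable PEmpty.{1} from inferInstance, show Countable ℤ from inferInstance,
    Countable.of_equiv ℤ Multiplicative.ofAdd⟩

/-- The perf-factorial slot at the tower, by the generic theorem for the constructed `Φ₀`-pieces (abc-iut-w6-d057's
`isPerfFactorialCof_phiZero`) — so that the statements below can be fired with a CANONICAL `hpf`.
[cite: MochizukiEtTh2009, Prop 3.4 p.74] -/
theorem hpf_canonical (Y : ((isConnectedGSet (G := Multiplicative ℤ)).FullSubcategory)ᵒᵖ) :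
    IsPerfFactorialCof ((DivisorMonoids.ofGaloisActionConnected TateTower.action TateTower.cuspLaws).Φ₀.obj Y) :=
  isPerfFactorialCof_phiZero TateTower.action Y.unop.obj

/-- **[EtTh] Cor. 3.8 (iii), first clause, AT THE TATE TOWER** — the cell's first NON-DEGENERATE §3 model (cusps `PEmpty`,
components `ℤ`, `G = ℤ`: the `hcnt` instance binders are found by instance search): for ANY rank-one points `P, P'` of
`TateTower.action`, any perf-factorial slots and category vocabularies, and EVERY Cor. 3.8 datum `h` between the two
rank-one-point tempered Frobenioids, `Cor38_iii h` holds modulo `Prop34Const` of the tower's Def. 3.3 (iii) record ONLY.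
[cite: MochizukiEtTh2009, Cor 3.8 p.81] -/
theorem cor38_iii_ofRankOnePoint
    (h : Cor38Hyp (TemperedFrobenioid.ofRankOnePoint TateTower.cuspLaws P hpf R S)
      (TemperedFrobenioid.ofRankOnePoint TateTower.cuspLaws P' hpf' R' S'))
    (hC : (DivisorMonoids.ofGaloisActionConnected TateTower.action TateTower.cuspLaws).Prop34Const) : Cor38_iii h := by
  haveI : Countable (Multiplicative ℤ) := Countable.of_equiv ℤ Multiplicative.ofAdd
  haveI : Countable TateTower.model.Cusp := show Countable PEmpty.{1} from inferInstance
  haveI : Countable TateTower.model.Comp := show Countable ℤ from inferInstance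
  exact TemperedFrobenioid.cor38_iii_ofRankOnePoint TateTower.cuspLaws P hpf R S TateTower.cuspLaws P' hpf' R' S' h hC hC

/-- **∃-form at the Tate tower**: modulo `Prop34Const` of the tower's record, `Cor38_iii` is INHABITED there.
[cite: MochizukiEtTh2009, Cor 3.8 p.81] -/
theorem exists_cor38Hyp_cor38_iii
    (hC : (DivisorMonoids.ofGaloisActionConnected TateTower.action TateTower.cuspLaws).Prop34Const) :
    ∃ h : Cor38Hyp (TemperedFrobenioid.ofRankOnePoint TateTower.cuspLaws P hpf R S)
      (TemperedFrobenioid.ofRankOnePoint TateTower.cuspLaws P hpf R S), Cor38_iii h := by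
  haveI : Countable (Multiplicative ℤ) := Countable.of_equiv ℤ Multiplicative.ofAdd
  haveI : Countable TateTower.model.Cusp := show Countable PEmpty.{1} from inferInstance
  haveI : Countable TateTower.model.Comp := show Countable ℤ from inferInstance
  exact TemperedFrobenioid.exists_cor38Hyp_cor38_iii_ofRankOnePoint TateTower.cuspLaws P hpf R S hC

/-! ### At abc-iut-w6-d048's instance of record `TateTowerFrd.temperedFrobenioid` (p446077) -/

/-- **[EtTh] Cor. 3.8 (iii), first clause, at THE tempered Frobenioid of record over the Tate tower**
(`TateTowerFrd.temperedFrobenioid R S = ofRankOnePoint TateTower.cuspLaws TateTowerFrd.rankOnePoint TateTowerFrd.hpf R S`,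
abc-iut-w6-d048, p446077): for EVERY Cor. 3.8 datum `h` between two such (any category-vocabulary slots), `Cor38_iii h`
modulo `Prop34Const` of the tower's Def. 3.3 (iii) record ONLY. [cite: MochizukiEtTh2009, Cor 3.8 p.81] -/
theorem cor38_iii_tateTowerFrd
    (h : Cor38Hyp (TateTowerFrd.temperedFrobenioid R S) (TateTowerFrd.temperedFrobenioid R' S'))
    (hC : (DivisorMonoids.ofGaloisActionConnected TateTower.action TateTower.cuspLaws).Prop34Const) : Cor38_iii h :=
  cor38_iii_ofRankOnePoint TateTowerFrd.rankOnePoint TateTowerFrd.rankOnePoint TateTowerFrd.hpf TateTowerFrd.hpf R S R' S' h hC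

/-- **∃-form at the instance of record**: modulo `Prop34Const` of the tower's record, `Cor38_iii` is inhabited between
`TateTowerFrd.temperedFrobenioid R S` and itself. [cite: MochizukiEtTh2009, Cor 3.8 p.81] -/
theorem exists_cor38Hyp_cor38_iii_tateTowerFrd
    (hC : (DivisorMonoids.ofGaloisActionConnected TateTower.action TateTower.cuspLaws).Prop34Const) :
    ∃ h : Cor38Hyp (TateTowerFrd.temperedFrobenioid R S) (TateTowerFrd.temperedFrobenioid R S), Cor38_iii h :=
  exists_cor38Hyp_cor38_iii TateTowerFrd.rankOnePoint TateTowerFrd.hpf R S hC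

end LogDivisorModel.TateTower


/-! ## Part 2: monoid type `ℝ` twins (abc-iut-w6-d048's `ofRankOnePointR`, p447026) and the HYPOTHESIS-FREE forms at the
Tate tower (`Prop34Const` there = `LogDivisorModel.TateTower.prop34Const_ofGaloisActionConnected`, abc-iut-w6-d052 p448109) -/

namespace TemperedFrobenioid

variable {Z : LogDivisorModel.{0}} {G : Type} [Group G] {A : Z.GaloisAction G} (hZ : Z.CuspLaws) (P : RankOnePoint A)
  (hpf : ∀ Y : ((isConnectedGSet (G := G)).FullSubcategory)ᵒᵖ,
    IsPerfFactorialCof ((DivisorMonoids.ofGaloisActionConnected A hZ).Φ₀.obj Y))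
  (R S : ((Discrete PUnit.{1})ᵒᵖ ⥤ CommMonCat.{0}) → Prop)
  {Z' : LogDivisorModel.{0}} {G' : Type} [Group G'] {A' : Z'.GaloisAction G'} (hZ' : Z'.CuspLaws) (P' : RankOnePoint A')
  (hpf' : ∀ Y : ((isConnectedGSet (G := G')).FullSubcategory)ᵒᵖ,
    IsPerfFactorialCof ((DivisorMonoids.ofGaloisActionConnected A' hZ').Φ₀.obj Y))
  (R' S' : ((Discrete PUnit.{1})ᵒᵖ ⥤ CommMonCat.{0}) → Prop)

/-- **`hcnt` at a `Λ = ℝ` rank-one point, CLOSED** (same image monoid `ι(Φ₀(Y_B)^pf)`). [cite: MochizukiEtTh2009, Ex 3.9 p.84] -/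
theorem countable_primes_perfection_Φ_ofRankOnePointR [Countable G] [Countable Z.Cusp] [Countable Z.Comp]
    (B : (Discrete PUnit.{1})ᵒᵖ) : Countable (Primes (Perfection ↥((ofRankOnePointR hZ P hpf R S).Φ.carrier B))) := by
  have hM := hpf ((ofRankOnePointR hZ P hpf R S).baseOp B)
  haveI := DivisorMonoids.countable_primes_perfection_Φ₀_ofGaloisActionConnected A hZ ((ofRankOnePointR hZ P hpf R S).baseOp B)
  haveI : Countable (Primes ↥(MonoidHom.mrange hM.weak.toRealification)) :=
    countable_primes_of_mulEquiv
      (MulEquiv.ofBijective _ (PfImageWeak.mrangeRestrict_toRealification_bijective hM.weak))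
  exact (PfImageWeak.isPerfFactorialCof_mrange_toRealification hM).weak.countable_primes_perfection

/-- **[EtTh] Cor. 3.8 (iii), first clause, monoid type `ℝ`, between two rank-one-point Frobenioids `ofRankOnePointR`** (countable
`G`, cusps, components): residual = `Prop34Const` only (abc-iut-L2-d2's `Λ = ℝ` apex `cor38_iii_ofRlfRWeak_of_isFrobenioid_of_countable_of_prop34Const`
p443086 ∘ `countable_primes_perfection_Φ_ofRankOnePointR` ∘ abc-iut-w6-d048's `ofRlfRWeak_hBinj_ofGaloisActionConnected`).
[cite: MochizukiEtTh2009, Cor 3.8 p.81] -/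
theorem cor38_iii_ofRankOnePointR [Countable G] [Countable Z.Cusp] [Countable Z.Comp] [Countable G'] [Countable Z'.Cusp]
    [Countable Z'.Comp] (h : Cor38Hyp (ofRankOnePointR hZ P hpf R S) (ofRankOnePointR hZ' P' hpf' R' S'))
    (hC : (DivisorMonoids.ofGaloisActionConnected A hZ).Prop34Const)
    (hC' : (DivisorMonoids.ofGaloisActionConnected A' hZ').Prop34Const) : Cor38_iii h :=
  cor38_iii_ofRlfRWeak_of_isFrobenioid_of_countable_of_prop34Const h
    (fun B => countable_primes_perfection_Φ_ofRankOnePointR hZ P hpf R S B)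
    (fun B => countable_primes_perfection_Φ_ofRankOnePointR hZ' P' hpf' R' S' B) hC hC'
    ((ofRankOnePointR hZ P hpf R S).isFrobenioid_of_isOfFSMType
      (RealifiedDivisorMonoids.ofRlfRWeak_hBinj_ofGaloisActionConnected A hZ hpf) PadicFrd.isOfFSMType_discretePUnit)
    ((ofRankOnePointR hZ' P' hpf' R' S').isFrobenioid_of_isOfFSMType
      (RealifiedDivisorMonoids.ofRlfRWeak_hBinj_ofGaloisActionConnected A' hZ' hpf') PadicFrd.isOfFSMType_discretePUnit)

end TemperedFrobenioid

namespace LogDivisorModel.TateTower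

open TemperedFrobenioid

variable (P P' : RankOnePoint TateTower.action)
  (hpf hpf' : ∀ Y : ((isConnectedGSet (G := Multiplicative ℤ)).FullSubcategory)ᵒᵖ,
    IsPerfFactorialCof ((DivisorMonoids.ofGaloisActionConnected TateTower.action TateTower.cuspLaws).Φ₀.obj Y))
  (R S R' S' : ((Discrete PUnit.{1})ᵒᵖ ⥤ CommMonCat.{0}) → Prop)

/-- **[EtTh] Cor. 3.8 (iii), first clause, AT THE TATE TOWER WITH NO HYPOTHESIS** (monoid type `ℤ`): for ANY rank-one points and
EVERY Cor. 3.8 datum `h`, `Cor38_iii h` — `Prop34Const` of the tower's record is p448109's theorem.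
[cite: MochizukiEtTh2009, Cor 3.8 p.81] -/
theorem cor38_iii_ofRankOnePoint_unconditional
    (h : Cor38Hyp (TemperedFrobenioid.ofRankOnePoint TateTower.cuspLaws P hpf R S)
      (TemperedFrobenioid.ofRankOnePoint TateTower.cuspLaws P' hpf' R' S')) : Cor38_iii h :=
  cor38_iii_ofRankOnePoint P P' hpf hpf' R S R' S' h prop34Const_ofGaloisActionConnected

/-- **∃-form, no hypothesis**: `Cor38_iii` is INHABITED at the Tate tower. [cite: MochizukiEtTh2009, Cor 3.8 p.81] -/
theorem exists_cor38Hyp_cor38_iii_unconditional :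
    ∃ h : Cor38Hyp (TemperedFrobenioid.ofRankOnePoint TateTower.cuspLaws P hpf R S)
      (TemperedFrobenioid.ofRankOnePoint TateTower.cuspLaws P hpf R S), Cor38_iii h :=
  exists_cor38Hyp_cor38_iii P hpf R S prop34Const_ofGaloisActionConnected

/-- **At the instance of record, no hypothesis** (`TateTowerFrd.temperedFrobenioid`, monoid type `ℤ`). [cite: MochizukiEtTh2009, Cor 3.8 p.81] -/
theorem cor38_iii_tateTowerFrd_unconditional
    (h : Cor38Hyp (TateTowerFrd.temperedFrobenioid R S) (TateTowerFrd.temperedFrobenioid R' S')) : Cor38_iii h :=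
  cor38_iii_tateTowerFrd R S R' S' h prop34Const_ofGaloisActionConnected

/-- **Monoid type `ℝ` at the Tate tower, no hypothesis**: for ANY rank-one points and EVERY Cor. 3.8 datum between the `Λ = ℝ`
rank-one-point Frobenioids. [cite: MochizukiEtTh2009, Cor 3.8 p.81] -/
theorem cor38_iii_ofRankOnePointR_unconditional
    (h : Cor38Hyp (TemperedFrobenioid.ofRankOnePointR TateTower.cuspLaws P hpf R S)
      (TemperedFrobenioid.ofRankOnePointR TateTower.cuspLaws P' hpf' R' S')) : Cor38_iii h := by
  haveI : Countable (Multiplicative ℤ) := Countable.of_equiv ℤ Multiplicative.ofAdd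
  haveI : Countable TateTower.model.Cusp := show Countable PEmpty.{1} from inferInstance
  haveI : Countable TateTower.model.Comp := show Countable ℤ from inferInstance
  exact TemperedFrobenioid.cor38_iii_ofRankOnePointR TateTower.cuspLaws P hpf R S TateTower.cuspLaws P' hpf' R' S' h
    prop34Const_ofGaloisActionConnected prop34Const_ofGaloisActionConnected

/-- **At the `Λ = ℝ` instance of record, no hypothesis** (`TateTowerFrd.temperedFrobenioidR`, abc-iut-w6-d048 p447026).
[cite: MochizukiEtTh2009, Cor 3.8 p.81] -/
theorem cor38_iii_tateTowerFrdR_unconditional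
    (h : Cor38Hyp (TateTowerFrd.temperedFrobenioidR R S) (TateTowerFrd.temperedFrobenioidR R' S')) : Cor38_iii h :=
  cor38_iii_ofRankOnePointR_unconditional TateTowerFrd.rankOnePoint TateTowerFrd.rankOnePoint TateTowerFrd.hpf TateTowerFrd.hpf
    R S R' S' h

end LogDivisorModel.TateTower

end Literature.AnabelianGeometry.EtaleTheta

end
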